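import Literature.IUT.HodgeTheaters.PMBaseBridges

/-!
# [IUTchI] §6, Propositions 6.5 and 6.6: transport of `±`-label classes; first properties of base bridges

Mochizuki, *Inter-universal Teichmüller theory I*, §6, Proposition 6.5 (i)–(iv) pp. 163–165 and
Proposition 6.6 (i)–(v) pp. 165–166, kurims manuscript (May 2020)
([IUTchI] Prop 6.5-6.6 pp.163-166) [claim: Mochizuki2012, status: disputed], typed as named `Prop`-valued statements over
the bridges of `PMBaseBridges.lean` (statements-first: IUT results are never asserted; the ones that
"follow immediately from the definitions" AND from our interface are proved where cheap —
Prop 6.5 (iv) is `labOfHom_post`).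

Rendering conventions. "The bridge induces a [single, well-defined!] bijection `ζ`" = there is ONE
bijection agreeing with the map on `±`-label classes induced by EVERY member of the poly-morphism
(`ZetaSpec`). "Compatible with the `𝔽_l^±`-group / -torsor structures" = charts pull back to charts
(`FlPMGroup.Compat`, `FlPMTorsor.Compat`). The torsor statements of Prop 6.6 (i)–(iv) are guarded by
`Nonempty 𝕍` (Def 3.1: `𝕍 ⥲ 𝕍_mod` is nonempty; over a kit with `𝕍 = ∅` the compatibility conditions of
an isomorphism are empty and the counts fail — observation of abc-iut-L5-t13). `LabCusp^±(†𝔇_t)` ("obtained by identifying the various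
`LabCusp^±(†𝒟_{v_t})` via the `†ξ_{v_t,w_t}`") is not materialised as a quotient: every statement
about it is made for `LabCusp^±(†𝒟_{v_t})` at an arbitrary `v`, the identifications `ξ` being
group-compatible (Prop 6.5 (i), (ii)). "Forms a torsor over `G`" (Prop 6.6) is rendered by
nonemptiness plus the printed bijection with the relevant set of index-set isomorphisms and, for
(i), (iv), unique existence of the isomorphism with prescribed discrete invariants (index bijection /
sign vector `α ∈ {±1}^𝕍`), which is what makes the set a torsor under the poly-automorphisms of
Example 6.2 (ii), (iii); the acting group is named in each docstring.
-/

namespace Literature.IUT.HodgeTheaters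

open CategoryTheory

universe u

/-- A bijection `φ : E₁ ≃ E₂` between `𝔽_l^±`-groups is *compatible with the `𝔽_l^±`-group structures*
if it pulls charts back to charts ([IUTchI] Prop 6.5 (i) p. 164 "compatible with the respective
`𝔽_l^±`-group structures"). ([IUTchI] Prop 6.5 (i) p.164) [claim: Mochizuki2012, status: disputed] -/
def FlPMGroup.Compat {l : ℕ} {E₁ E₂ : Type*} (S₁ : FlPMGroup l E₁) (S₂ : FlPMGroup l E₂)
    (φ : E₁ ≃ E₂) : Prop :=
  ∀ e ∈ S₂.charts, φ.trans e ∈ S₁.charts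

/-- A bijection between `𝔽_l^±`-torsors is *compatible with the `𝔽_l^±`-torsor structures* if it pulls
charts back to charts ([IUTchI] Prop 6.5 (i) p. 163 "compatible with the respective `𝔽_l^±`-torsor
structures"). ([IUTchI] Prop 6.5 (i) p.163) [claim: Mochizuki2012, status: disputed] -/
def FlPMTorsor.Compat {l : ℕ} {E₁ E₂ : Type*} (S₁ : FlPMTorsor l E₁) (S₂ : FlPMTorsor l E₂)
    (φ : E₁ ≃ E₂) : Prop :=
  ∀ e ∈ S₂.charts, φ.trans e ∈ S₁.charts

namespace PMBaseKit

variable {l : ℕ} {K : PMBaseKit.{u} l}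

/-! ### Proposition 6.5 (i): `ζ^{Θell}`, `ξ^{Θell}` -/

namespace DThetaEllBridge

variable (B : K.DThetaEllBridge)

/-- `†ζ^{Θell}_{v_t} : LabCusp^±(†𝒟_{v_t}) ⥲ LabCusp^±(†𝒟^{⊚±})` is *the* bijection induced by the
`𝒟-Θ^{ell}`-bridge at `(t, v)`: it agrees with the map on `±`-label classes induced by every member of
the poly-morphism `†φ^{Θell}_{v_t}` and is compatible with the respective `𝔽_l^±`-torsor structures
([IUTchI] Prop 6.5 (i) p. 163) — the torsor structure on `LabCusp^±(†𝒟^{⊚±})` being the one transported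
from `𝒟^{⊚±}` along an isomorphism exhibiting the bridge (`gLabTOf`; another choice differs by an element
of `Aut_±`, which preserves it — Prop 6.5 (iv)). ([IUTchI] Prop 6.5 (i) p.163) [claim: Mochizuki2012, status: disputed] -/
def ZetaSpec (t : B.T) (v : K.V) (ζ : K.LabCuspPM v ((B.capsule t).obj v) ≃ K.GLab B.glob) : Prop :=
  (∀ f ∈ B.poly t v, K.labOfHom v f = ζ) ∧
    ∃ β : K.gModel ≅ B.glob, B.Exhibits β ∧
      (K.labPM v _ ((B.capsule t).isLocal v)).toTorsor.Compat (K.gLabTOf β) ζ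

/-- **Prop 6.5 (i), first sentence**: "for each `v ∈ 𝕍`, `t ∈ T`, the `𝒟-Θ^{ell}`-bridge `†φ^{Θell}_±`
induces a [single, well-defined!] bijection of sets of ±-label classes of cusps
`†ζ^{Θell}_{v_t} : LabCusp^±(†𝒟_{v_t}) ⥲ LabCusp^±(†𝒟^{⊚±})` that is compatible with the respective
`𝔽_l^±`-torsor structures" ([IUTchI] Prop 6.5 (i) p. 163) — named statement.
([IUTchI] Prop 6.5 (i) p.163) [claim: Mochizuki2012, status: disputed] -/
def InducesZeta : Prop := ∀ (t : B.T) (v : K.V), ∃ ζ, B.ZetaSpec t v ζ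

/-- **Prop 6.5 (i), second sentence**: "for `w ∈ 𝕍`, the bijection
`†ξ^{Θell}_{v_t,w_t} := (†ζ^{Θell}_{w_t})⁻¹ ∘ †ζ^{Θell}_{v_t} : LabCusp^±(†𝒟_{v_t}) ⥲ LabCusp^±(†𝒟_{w_t})` is
compatible with the respective `𝔽_l^±`-group structures" ([IUTchI] Prop 6.5 (i) p. 164); the
remaining sentences ("write `LabCusp^±(†𝔇_t)` for the `𝔽_l^±`-group obtained by identifying the various
`LabCusp^±(†𝒟_{v_t})` via the `†ξ^{Θell}_{v_t,w_t}`"; `†ζ^{Θell}_t`) are the formal consequence — named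
statement. NOT derivable from `PMBaseKit` (v2) alone (audit abc-iut-L5-t6 R7-L5t4-F1); PROVED from the
synchronisation law `Ex63.PhiEllSync` of `PMBaseModels.lean` in `PMBaseDischarge.lean`
(`DThetaEllBridge.xiGroupCompat_of_sync`).
([IUTchI] Prop 6.5 (i) p.164) [claim: Mochizuki2012, status: disputed] -/
def XiGroupCompat : Prop :=
  ∀ (t : B.T) (v w : K.V) (ζv : K.LabCuspPM v ((B.capsule t).obj v) ≃ K.GLab B.glob)
    (ζw : K.LabCuspPM w ((B.capsule t).obj w) ≃ K.GLab B.glob),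
    B.ZetaSpec t v ζv → B.ZetaSpec t w ζw →
      (K.labPM v _ ((B.capsule t).isLocal v)).Compat (K.labPM w _ ((B.capsule t).isLocal w))
        (ζv.trans ζw.symm)

/-- **Prop 6.5 (iv)**: "Let `α ∈ Aut_±(†𝒟^{⊚±})/Aut_csp(†𝒟^{⊚±})`. Then if one replaces `†φ^{Θell}_±` by
`α ∘ †φ^{Θell}_±`, then the resulting `†ζ^{Θell}_t` is related to the `†ζ^{Θell}_t` determined by the
original `†φ^{Θell}_±` by post-composition with the image of `α` via the natural bijection
`Aut_±(†𝒟^{⊚±})/Aut_csp(†𝒟^{⊚±}) ⥲ Aut_±(LabCusp^±(†𝒟^{⊚±}))`" ([IUTchI] Prop 6.5 (iv) p. 165) — at the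
level of the inducing members this IS the naturality field `labOfHom_post` of the interface; PROVED.
([IUTchI] Prop 6.5 (iv) p.165) [claim: Mochizuki2012, status: disputed] -/
theorem zeta_postcomp (t : B.T) (v : K.V) (α : Aut B.glob) (f : (B.capsule t).obj v ⟶ (K.atV v).obj B.glob)
    (_hf : f ∈ B.poly t v) :
    K.labOfHom v (f ≫ (K.atV v).map α.hom) = K.gLabMap α ∘ K.labOfHom v f :=
  K.labOfHom_post v f α

end DThetaEllBridge

/-! ### Proposition 6.5 (ii): `ζ^{Θ±}`, `ξ^{Θ±}` -/

namespace DThetaPMBridge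

variable (B : K.DThetaPMBridge)

/-- `†ζ^{Θ±}_{v_t} : LabCusp^±(†𝒟_{v_t}) ⥲ LabCusp^±(†𝒟_{≻,v})` is *the* bijection induced by the
`𝒟-Θ^±`-bridge at `(t, v)`: it agrees with `LabCusp^±` of the `v`-component of every member of
`†φ^{Θ±}_t` and is compatible with the `𝔽_l^±`-group structures ([IUTchI] Prop 6.5 (ii) p. 164).
([IUTchI] Prop 6.5 (ii) p.164) [claim: Mochizuki2012, status: disputed] -/
def ZetaSpec (t : B.T) (v : K.V)
    (ζ : K.LabCuspPM v ((B.capsule t).obj v) ≃ K.LabCuspPM v (B.codomain.obj v)) : Prop :=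
  (∀ f ∈ B.poly t, K.labMap v (f v) = ζ) ∧
    (K.labPM v _ ((B.capsule t).isLocal v)).Compat (K.labPM v _ (B.codomain.isLocal v)) ζ

/-- **Prop 6.5 (ii), first sentence**: "for each `v ∈ 𝕍`, `t ∈ T`, the `𝒟-Θ^±`-bridge `†φ^{Θ±}_±` induces a
[single, well-defined!] bijection of sets of ±-label classes of cusps
`†ζ^{Θ±}_{v_t} : LabCusp^±(†𝒟_{v_t}) ⥲ LabCusp^±(†𝒟_{≻,v})` that is compatible with the respective
`𝔽_l^±`-group structures" ([IUTchI] Prop 6.5 (ii) p. 164) — named statement, PROVED below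
(`inducesZeta`). ([IUTchI] Prop 6.5 (ii) p.164) [claim: Mochizuki2012, status: disputed] -/
def InducesZeta : Prop := ∀ (t : B.T) (v : K.V), ∃ ζ, B.ZetaSpec t v ζ

/-- Members of one `+`-full poly-isomorphism induce the same bijection on `±`-label classes (they
differ by `Aut_+`, which acts trivially) — the mechanism behind "single, well-defined!" in Prop 6.5
(ii). ([IUTchI] Prop 6.5 (ii) p.164) [claim: Mochizuki2012, status: disputed] -/
theorem labMap_eq_of_mem_plusFullPolyIso {v : K.V} {X Y : K.Amb v} (φ : X ≅ Y) {ψ₁ ψ₂ : X ≅ Y}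
    (h₁ : ψ₁ ∈ K.plusFullPolyIso φ) (h₂ : ψ₂ ∈ K.plusFullPolyIso φ) : K.labMap v ψ₁ = K.labMap v ψ₂ := by
  obtain ⟨a₁, ha₁, rfl⟩ := h₁
  obtain ⟨a₂, ha₂, rfl⟩ := h₂
  rw [mem_autPlus_iff] at ha₁ ha₂
  rw [K.labMap_trans, K.labMap_trans, ha₁, ha₂]

/-- **Prop 6.5 (ii), first sentence — PROVED** from the interface: every `𝒟-Θ^±`-bridge induces the
bijections `†ζ^{Θ±}_{v_t}` (all members of `†φ^{Θ±}_t` differ from a fixed conjugate of the model by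
positive automorphisms, which act trivially on `±`-label classes; compatibility with the `𝔽_l^±`-group
structures is functoriality of `LabCusp^±`). ([IUTchI] Prop 6.5 (ii) p.164) [claim: Mochizuki2012, status: disputed] -/
theorem inducesZeta : B.InducesZeta := by
  intro t v
  obtain ⟨ι, -, α, β, hpoly⟩ := B.exists_model
  obtain ⟨z, rfl⟩ := ι.surjective t
  refine ⟨K.labMap v ((α z v).symm ≪≫ β v), fun f hf => ?_, fun e he => ?_⟩
  · rw [hpoly z] at hf
    obtain ⟨p, hp, rfl⟩ := hf
    have hpv : K.labMap v (p v) = Equiv.refl _ := (K.mem_autPlus_iff _).mp ((hp v).1 rfl)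
    show K.labMap v (((α z v).symm ≪≫ p v) ≪≫ β v) = _
    rw [K.labMap_trans, K.labMap_trans, K.labMap_trans, hpv, Equiv.trans_refl]
  · exact K.labMap_charts v ((B.capsule (ι z)).isLocal v) (B.codomain.isLocal v) _ e he

end DThetaPMBridge

namespace DThetaPMEllHT

variable (H : K.DThetaPMEllHT)

/-- **Prop 6.5 (ii), second sentence**: with `0 ∈ T` the zero element of the `𝔽_l^±`-group `T`,
`†ξ^{Θ±}_{≻,v,w} := †ζ^{Θ±}_{w_0} ∘ †ξ^{Θell}_{v_0,w_0} ∘ (†ζ^{Θ±}_{v_0})⁻¹ : LabCusp^±(†𝒟_{≻,v}) ⥲ LabCusp^±(†𝒟_{≻,w})`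
and `†ξ^{Θ±}_{v_t,w_t} := (†ζ^{Θ±}_{w_t})⁻¹ ∘ †ξ^{Θ±}_{≻,v,w} ∘ †ζ^{Θ±}_{v_t}` "are compatible with the
respective `𝔽_l^±`-group structures, and we have `†ξ^{Θ±}_{v_t,w_t} = †ξ^{Θell}_{v_t,w_t}`" ([IUTchI] Prop
6.5 (ii) p. 164; group-compatibility of composites of group-compatible bijections being formal, the
content recorded is the EQUALITY) — named statement. ([IUTchI] Prop 6.5 (ii) p.164) [claim: Mochizuki2012, status: disputed] -/
def XiPMEqXiEll : Prop :=
  ∀ (t : H.T) (v w : K.V)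
    (ζPv0 : K.LabCuspPM v ((H.capsule H.grpT.zero).obj v) ≃ K.LabCuspPM v (H.codomain.obj v))
    (ζPw0 : K.LabCuspPM w ((H.capsule H.grpT.zero).obj w) ≃ K.LabCuspPM w (H.codomain.obj w))
    (ζPvt : K.LabCuspPM v ((H.capsule t).obj v) ≃ K.LabCuspPM v (H.codomain.obj v))
    (ζPwt : K.LabCuspPM w ((H.capsule t).obj w) ≃ K.LabCuspPM w (H.codomain.obj w))
    (ζEv0 : K.LabCuspPM v ((H.capsule H.grpT.zero).obj v) ≃ K.GLab H.glob)
    (ζEw0 : K.LabCuspPM w ((H.capsule H.grpT.zero).obj w) ≃ K.GLab H.glob)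
    (ζEvt : K.LabCuspPM v ((H.capsule t).obj v) ≃ K.GLab H.glob)
    (ζEwt : K.LabCuspPM w ((H.capsule t).obj w) ≃ K.GLab H.glob),
    H.pmBridge.ZetaSpec H.grpT.zero v ζPv0 → H.pmBridge.ZetaSpec H.grpT.zero w ζPw0 →
    H.pmBridge.ZetaSpec t v ζPvt → H.pmBridge.ZetaSpec t w ζPwt →
    H.ellBridge.ZetaSpec H.grpT.zero v ζEv0 → H.ellBridge.ZetaSpec H.grpT.zero w ζEw0 →
    H.ellBridge.ZetaSpec t v ζEvt → H.ellBridge.ZetaSpec t w ζEwt →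
      (ζPvt.trans ((ζPv0.symm.trans ((ζEv0.trans ζEw0.symm).trans ζPw0)).trans ζPwt.symm)) =
        ζEvt.trans ζEwt.symm

/-! ### Proposition 6.5 (iii): `ζ_±` -/

/-- **Prop 6.5 (iii), first sentence**: "the assignment `T ∋ t ↦ †ζ^{Θell}_t(0) ∈ LabCusp^±(†𝒟^{⊚±})` —
where … `0` [is] the zero element of the `𝔽_l^±`-group `LabCusp^±(†𝔇_t)` — determines a [single,
well-defined!] bijection `(†ζ_±)⁻¹ : T ⥲ LabCusp^±(†𝒟^{⊚±})` which is compatible with the respective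
`𝔽_l^±`-torsor structures" ([IUTchI] Prop 6.5 (iii) pp. 164–165), read at any `v ∈ 𝕍` — named
statement. ([IUTchI] Prop 6.5 (iii) p.164) [claim: Mochizuki2012, status: disputed] -/
def ZetaPMInvSpec : Prop :=
  ∀ (v : K.V) (ζ : ∀ t : H.T, K.LabCuspPM v ((H.capsule t).obj v) ≃ K.GLab H.glob),
    (∀ t, H.ellBridge.ZetaSpec t v (ζ t)) →
      ∃ hb : Function.Bijective fun t => ζ t (K.labPM v _ ((H.capsule t).isLocal v)).zero,
        ∃ β : K.gModel ≅ H.glob, H.ellBridge.Exhibits β ∧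
          H.grpT.toTorsor.Compat (K.gLabTOf β) (Equiv.ofBijective _ hb)

/-- **Prop 6.5 (iii), second sentence**: "for any `t ∈ T`, the composite bijection
`(†ζ^{Θell}_0)⁻¹ ∘ (†ζ^{Θell}_t) ∘ (†ζ^{Θ±}_t)⁻¹ ∘ (†ζ^{Θ±}_0) : LabCusp^±(†𝔇_0) ⥲ LabCusp^±(†𝔇_0)` coincides
with the automorphism of the set `LabCusp^±(†𝔇_0)` determined, relative to the `𝔽_l^±`-group structure
on this set, by the action of `(†ζ^{Θell}_0)⁻¹((†ζ_±)⁻¹(t))`" ([IUTchI] Prop 6.5 (iii) p. 165), read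
at any `v` (translation by that element: every chart `e` sends the composite to `y ↦ e y + e x`) —
named statement. ([IUTchI] Prop 6.5 (iii) p.165) [claim: Mochizuki2012, status: disputed] -/
def ZetaCompositeIsTranslation : Prop :=
  ∀ (v : K.V) (t : H.T)
    (ζP0 : K.LabCuspPM v ((H.capsule H.grpT.zero).obj v) ≃ K.LabCuspPM v (H.codomain.obj v))
    (ζPt : K.LabCuspPM v ((H.capsule t).obj v) ≃ K.LabCuspPM v (H.codomain.obj v))
    (ζE0 : K.LabCuspPM v ((H.capsule H.grpT.zero).obj v) ≃ K.GLab H.glob)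
    (ζEt : K.LabCuspPM v ((H.capsule t).obj v) ≃ K.GLab H.glob),
    H.pmBridge.ZetaSpec H.grpT.zero v ζP0 → H.pmBridge.ZetaSpec t v ζPt →
    H.ellBridge.ZetaSpec H.grpT.zero v ζE0 → H.ellBridge.ZetaSpec t v ζEt →
      let S₀ := K.labPM v _ ((H.capsule H.grpT.zero).isLocal v)
      let x := ζE0.symm (ζEt (K.labPM v _ ((H.capsule t).isLocal v)).zero)
      ∀ e ∈ S₀.charts, ∀ y,
        e ((ζP0.trans (ζPt.symm.trans (ζEt.trans ζE0.symm))) y) = e y + e x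

end DThetaPMEllHT

/-! ### Proposition 6.6: first properties -/

namespace DThetaPMBridge

/-- **Prop 6.6 (i)**: "The set of isomorphisms between two `𝒟-Θ^±`-bridges forms a torsor over the group
`{±1} × ({±1}^𝕍)` — where the first (respectively, second) factor corresponds to poly-automorphisms of
the sort described in Example 6.2, (ii) (respectively, Example 6.2, (iii)). Moreover, the first factor
may be thought of as corresponding to the induced isomorphisms of `𝔽_l^±`-groups between the index
sets of the capsules involved" ([IUTchI] Prop 6.6 (i) p. 165). Rendered: isomorphisms exist, and for
any one of them, `f`, every `(s, α) ∈ {±1} × {±1}^𝕍` is realised by exactly one isomorphism `g` —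
with index bijection `f`'s (for `s = 1`) or `f`'s followed by `t ↦ −t` (for `s = −1`), and with
`+`-full poly-isomorphism `†𝔇_≻ ⥲ ‡𝔇_≻` equal to `f`'s followed by `Aut^α(‡𝔇_≻)` — and every `g` arises
so. ([IUTchI] Prop 6.6 (i) p.165) [claim: Mochizuki2012, status: disputed] -/
def IsoTorsor (B₁ B₂ : K.DThetaPMBridge) : Prop :=
  Nonempty K.V → Nonempty (Iso B₁ B₂) ∧
    ∀ f : Iso B₁ B₂,
      (∀ (s : ℤˣ) (α : K.V → ℤˣ), ∃! g : Iso B₁ B₂,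
        g.indexEquiv = (if s = 1 then f.indexEquiv else f.indexEquiv.trans B₂.grpT.neg) ∧
          g.codPoly = DStrip.polyComp f.codPoly (B₂.codomain.signedPolyAut α)) ∧
      ∀ g : Iso B₁ B₂, ∃ (s : ℤˣ) (α : K.V → ℤˣ),
        g.indexEquiv = (if s = 1 then f.indexEquiv else f.indexEquiv.trans B₂.grpT.neg) ∧
          g.codPoly = DStrip.polyComp f.codPoly (B₂.codomain.signedPolyAut α)

end DThetaPMBridge

namespace DThetaEllBridge

/-- **Prop 6.6 (ii)**: "The set of isomorphisms between two `𝒟-Θ^{ell}`-bridges forms an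
`𝔽_l^{⋊±}`-torsor — i.e., more precisely, a torsor over a finite group that is equipped with a natural
outer isomorphism to `𝔽_l^{⋊±}`. Moreover, this set of isomorphisms maps bijectively, by considering
the induced bijections, to the set of isomorphisms of `𝔽_l^±`-torsors between the index sets of the
capsules involved" ([IUTchI] Prop 6.6 (ii) p. 165). Rendered: nonempty, and `g ↦` (its index
bijection) is a bijection onto the torsor-compatible bijections `T ⥲ T'` (themselves an
`𝔽_l^{⋊±}`-torsor). ([IUTchI] Prop 6.6 (ii) p.165) [claim: Mochizuki2012, status: disputed] -/
def IsoTorsor (B₁ B₂ : K.DThetaEllBridge) : Prop :=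
  Nonempty K.V → Nonempty (Iso B₁ B₂) ∧
    Function.Bijective fun g : Iso B₁ B₂ =>
      (⟨g.indexEquiv, g.indexEquiv_charts⟩ : {ι : B₁.T ≃ B₂.T // B₁.torT.Compat B₂.torT ι})

end DThetaEllBridge

namespace DThetaPMEllHT

/-- **Prop 6.6 (iii)**: "The set of isomorphisms between two `𝒟-Θ^{±ell}`-Hodge theaters forms a
`{±1}`-torsor. Moreover, this set of isomorphisms maps bijectively, by considering the induced
bijections, to the set of isomorphisms of `𝔽_l^±`-groups between the index sets of the capsules
involved" ([IUTchI] Prop 6.6 (iii) p. 165). Rendered: nonempty, and `g ↦` (its index bijection) is a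
bijection onto the group-compatible bijections `T ⥲ T'` (of which there are two).
([IUTchI] Prop 6.6 (iii) p.165) [claim: Mochizuki2012, status: disputed] -/
def IsoTorsor (H₁ H₂ : K.DThetaPMEllHT) : Prop :=
  Nonempty K.V → Nonempty (Iso H₁ H₂) ∧
    Function.Bijective fun g : Iso H₁ H₂ =>
      (⟨g.pmIso.indexEquiv, g.pmIso.indexEquiv_charts⟩ : {ι : H₁.T ≃ H₂.T // H₁.grpT.Compat H₂.grpT ι})

end DThetaPMEllHT

/-! ### Proposition 6.6 (iv), (v): gluing -/

/-- A capsule-`+`-full poly-isomorphism `†𝔇_T ⥲ ‡𝔇_{T'}` between the capsules of a `𝒟-Θ^±`-bridge and a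
`𝒟-Θ^{ell}`-bridge: a bijection of index sets and `+`-full poly-isomorphisms of the constituents
([IUTchI] Def 6.1 (iv) p. 157; Prop 6.6 (iv) p. 166). ([IUTchI] Prop 6.6 (iv) p.166) [claim: Mochizuki2012, status: disputed] -/
structure GluingData (B : K.DThetaPMBridge) (B' : K.DThetaEllBridge) where
  /-- the bijection of index sets -/
  indexEquiv : B.T ≃ B'.T
  /-- the constituent poly-isomorphisms -/
  poly : ∀ t, Set ((B.capsule t).Iso (B'.capsule (indexEquiv t)))
  /-- each is `+`-full -/
  poly_plusFull : ∀ t, DStrip.IsPlusFullPolyIso (poly t)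

/-- The `𝒟-Θ^{ell}`-bridge poly-morphisms transported back along a gluing datum:
`†𝒟_{v_t} ⥲ ‡𝒟_{v_{ι t}} → ‡𝒟^{⊚±}` ([IUTchI] Prop 6.6 (iv) p. 166 "glue … together").
([IUTchI] Prop 6.6 (iv) p.166) [claim: Mochizuki2012, status: disputed] -/
def GluingData.polyEll {B : K.DThetaPMBridge} {B' : K.DThetaEllBridge} (G : GluingData B B')
    (t : B.T) (v : K.V) : Set ((B.capsule t).obj v ⟶ (K.atV v).obj B'.glob) :=
  {h | ∃ p ∈ G.poly t, ∃ g ∈ B'.poly (G.indexEquiv t) v, h = (p v).hom ≫ g}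

/-- A gluing datum "allows one to glue the given `𝒟-Θ^±`- and `𝒟-Θ^{ell}`-bridges together to form a
`𝒟-Θ^{±ell}`-Hodge theater" ([IUTchI] Prop 6.6 (iv) p. 166): its index bijection is an isomorphism from
the torsor structure induced by the group structure of `T` to that of `T'`, and the data
`(†𝔇_≻ ⟵ †𝔇_T ⟶ ‡𝒟^{⊚±})` with the transported `Θ^{ell}`-poly-morphisms satisfy the model condition of
Def 6.4 (iii). ([IUTchI] Prop 6.6 (iv) p.166) [claim: Mochizuki2012, status: disputed] -/
def GluingData.Glues {B : K.DThetaPMBridge} {B' : K.DThetaEllBridge} (G : GluingData B B') : Prop :=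
  B.grpT.toTorsor.Compat B'.torT G.indexEquiv ∧
    ∃ (ι : ZMod l ≃ B.T) (_ : ∀ e ∈ B.grpT.charts, ι.trans e ∈ (FlPMGroup.tautological l).charts)
      (α : ∀ z, (DStrip.model K).Iso (B.capsule (ι z))) (β : (DStrip.model K).Iso B.codomain)
      (γ : K.gModel ≅ B'.glob),
      (∀ z, B.poly (ι z) = DStrip.polyConj (α z) β (Ex62.poly K z)) ∧
        ∀ z v, G.polyEll (ι z) v = K.ellConj (α z) γ v (Ex63.poly K z v)

/-- The `𝒟-Θ^{±ell}`-Hodge theater obtained by gluing along a gluing datum that glues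
([IUTchI] Prop 6.6 (iv) p. 166). ([IUTchI] Prop 6.6 (iv) p.166) [claim: Mochizuki2012, status: disputed] -/
def GluingData.glue {B : K.DThetaPMBridge} {B' : K.DThetaEllBridge} (G : GluingData B B')
    (hG : G.Glues) : K.DThetaPMEllHT where
  T := B.T
  grpT := B.grpT
  capsule := B.capsule
  codomain := B.codomain
  polyPM := B.poly
  glob := B'.glob
  polyEll := G.polyEll
  exists_model := hG.2

/-- **Prop 6.6 (iv)**: "Given a `𝒟-Θ^±`-bridge and a `𝒟-Θ^{ell}`-bridge, the set of capsule-`+`-full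
poly-isomorphisms between the respective capsules of `𝒟`-prime-strips which allow one to glue the given
`𝒟-Θ^±`- and `𝒟-Θ^{ell}`-bridges together to form a `𝒟-Θ^{±ell}`-Hodge theater forms a torsor over the
group `𝔽_l^{⋊±} × ({±1}^𝕍)` — where the first factor corresponds to the `𝔽_l^{⋊±}` of (ii); the subgroup
`{±1} × ({±1}^𝕍)` corresponds to the group of (i). Moreover, the first factor may be thought of as
corresponding to the induced isomorphisms of `𝔽_l^±`-torsors between the index sets of the capsules
involved" ([IUTchI] Prop 6.6 (iv) p. 166). Rendered: gluing data exist; their index bijections are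
exactly the torsor-isomorphisms `T ⥲ T'` (an `𝔽_l^{⋊±}`-torsor); over each such bijection the gluing data
correspond bijectively to `{±1}^𝕍`. ([IUTchI] Prop 6.6 (iv) p.166) [claim: Mochizuki2012, status: disputed] -/
def GluingTorsor (B : K.DThetaPMBridge) (B' : K.DThetaEllBridge) : Prop :=
  Nonempty K.V → (∃ G : GluingData B B', G.Glues) ∧
    (∀ ι : B.T ≃ B'.T, B.grpT.toTorsor.Compat B'.torT ι → ∃ G : GluingData B B', G.Glues ∧ G.indexEquiv = ι) ∧
    ∀ ι : B.T ≃ B'.T, B.grpT.toTorsor.Compat B'.torT ι →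
      Nonempty ({G : GluingData B B' // G.Glues ∧ G.indexEquiv = ι} ≃ (K.V → ℤˣ))

/-- **Prop 6.6 (v)**: "Given a `𝒟-Θ^{ell}`-bridge, there exists a [relatively simple — cf. the discussion
of Example 6.2, (i)] functorial algorithm for constructing, up to an `𝔽_l^{⋊±}`-indeterminacy [cf. (ii),
(iv)], from the given `𝒟-Θ^{ell}`-bridge a `𝒟-Θ^{±ell}`-Hodge theater whose underlying `𝒟-Θ^{ell}`-bridge
is the given `𝒟-Θ^{ell}`-bridge" ([IUTchI] Prop 6.6 (v) p. 166). Rendered: every `𝒟-Θ^{ell}`-bridge is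
isomorphic to the underlying `𝒟-Θ^{ell}`-bridge of some `𝒟-Θ^{±ell}`-Hodge theater.
([IUTchI] Prop 6.6 (v) p.166) [claim: Mochizuki2012, status: disputed] -/
def ExtendsToHT (B' : K.DThetaEllBridge) : Prop :=
  ∃ H : K.DThetaPMEllHT, Nonempty (DThetaEllBridge.Iso H.ellBridge B')

end PMBaseKit

end Literature.IUT.HodgeTheaters
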